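import Summits.ResolutionOfSingularities.ResolutionOfSingularities.Theses.WeightedInvariant
import Summits.ResolutionOfSingularities.ResolutionOfSingularities.Theorems.WeightedInvariantWeightedThesisProjectiveIntegralSuffices
import Literature.AlgebraicGeometry.Motives.VarietiesProjectiveSpaceProofs

/-!
# `WeightedThesis` — glue: the target derived by name from the route's items (II)

Support lemmas for crux `stmt-ResolutionOfSingularities-0569`
(`Summit.ResolutionOfSingularities.ResolutionOfSingularities.Theses.WeightedInvariant.WeightedThesis`),
line `datum-glued-split` (lead prover-line-stmt-ResolutionOfSingularities-0569-0). Part (I)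
(`Theorems/WeightedInvariantWeightedThesisGlue.lean`) derives the target from
`WeightedConstruction` + `DatumToResolution`; this part closes the triangle through the support
item `DatumToEmbedded` (stmt-0572):

* `datumToResolution_of_datumToEmbedded` — `DatumToEmbedded → DatumToResolution`: at a prime `p`
  and a perfect field `k` of characteristic `p`, embedded resolution of the integral closed
  subschemes of the smooth separated quasi-compact `k`-schemes applies to every `ℙⁿ_k`
  (smooth of relative dimension `n`, `isSmoothProjective_projectiveSpace_holds`; proper, hence
  separated and quasi-compact, `isProper_projectiveSpace`), and the integral closed subschemes
  of the `ℙⁿ_k` suffice for all reduced separated `k`-schemes of finite type (the line's stub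
  `stub_projectiveIntegralSuffices`, landed: components + Chow + projective closure). This is
  the sentence "previous + ChowLemmaIntegral_holds + hasResolution_of_irreducibleComponents" of
  the route's description of stmt-8974, as a theorem.
* `weightedThesis_of_weightedConstruction_of_datumToEmbedded` —
  `WeightedConstruction → DatumToEmbedded → WeightedThesis`.

No definition is declared; the two `ℙⁿ_k` instances are introduced locally (`haveI`).
-/

noncomputable section

open CategoryTheory AlgebraicGeometry
open Literature.AlgebraicGeometry.Resolution
open Summit.ResolutionOfSingularities.ResolutionOfSingularities.Theses.WeightedInvariant

set_option linter.dupNamespace false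

namespace Summit.ResolutionOfSingularities.ResolutionOfSingularities.Theorems.WeightedThesis.Glue

/-- **`DatumToEmbedded → DatumToResolution`.** If a weighted resolution datum in characteristic
`p` resolves every integral closed subscheme of every smooth separated quasi-compact scheme over
every perfect field of characteristic `p`, then it resolves every reduced separated scheme of
finite type over such a field: apply the hypothesis inside the projective spaces `ℙⁿ_k` and
spread by `stub_projectiveIntegralSuffices` (irreducible components, Chow's lemma, projective
closure). [folklore] -/
theorem datumToResolution_of_datumToEmbedded : Summit.ResolutionOfSingularities.ResolutionOfSingularities.Theses.WeightedInvariant.DatumToEmbedded → Summit.ResolutionOfSingularities.ResolutionOfSingularities.Theses.WeightedInvariant.DatumToResolution := by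
  intro hE p hp hD k _ _ _ X f hsep hlft hqc hred
  refine ProjectiveIntegralSuffices.stub_projectiveIntegralSuffices k (fun n Z ι hι hint => ?_)
    X f hsep hlft hqc hred
  haveI : SmoothOfRelativeDimension n (Literature.AlgebraicGeometry.Motives.projectiveSpace n k).hom :=
    (Literature.AlgebraicGeometry.Motives.isSmoothProjective_projectiveSpace_holds k n)
      |>.smoothOfRelativeDimension
  haveI : Smooth (Literature.AlgebraicGeometry.Motives.projectiveSpace n k).hom :=
    SmoothOfRelativeDimension.smooth n _
  haveI : IsProper (Literature.AlgebraicGeometry.Motives.projectiveSpace n k).hom :=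
    Literature.AlgebraicGeometry.Motives.isProper_projectiveSpace n k
  exact hE p hp hD k (Literature.AlgebraicGeometry.Motives.projectiveSpace n k).left Z
    (Literature.AlgebraicGeometry.Motives.projectiveSpace n k).hom ι inferInstance inferInstance
    inferInstance hι hint

/-- **The target derived by name through `DatumToEmbedded`**: a weighted resolution datum at
every prime (`WeightedConstruction`, crux stmt-0571) and embedded resolution from the datum
(`DatumToEmbedded`, support stmt-0572) give `WeightedThesis`. [folklore] -/
theorem weightedThesis_of_weightedConstruction_of_datumToEmbedded : Summit.ResolutionOfSingularities.ResolutionOfSingularities.Theses.WeightedInvariant.WeightedConstruction → Summit.ResolutionOfSingularities.ResolutionOfSingularities.Theses.WeightedInvariant.DatumToEmbedded → Summit.ResolutionOfSingularities.ResolutionOfSingularities.Theses.WeightedInvariant.WeightedThesis :=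
  fun hC hE p hp k _ _ _ X f hsep hlft hqc hred =>
    datumToResolution_of_datumToEmbedded hE p hp (hC p hp) k X f hsep hlft hqc hred

end Summit.ResolutionOfSingularities.ResolutionOfSingularities.Theorems.WeightedThesis.Glue

end
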